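import Summits.Ventures.CertifiedManyBodySolver.Theorems.TcThermcert1QbpLiebRobinsonSupported
import Summits.Ventures.CertifiedManyBodySolver.Theorems.TcThermcert1QbpSeamFamily
import Mathlib
import HarnessLib

/-!
# `TcThermcert1` — QBP chain, PART 7d: the leakage bound for the seam dynamics on the Hubbard torus

The hypothesis `hε` of PART 6 (`exists_qbp_conjugation_pair`) for stub B of the line `gauge_qbp_far_seam`, in closed
form up to the choice of the level functions: for `H = hubbardTorusTT'Flux L 0 U 0` (all Hubbard terms), `H_T` (the
terms kept in a collar `X` of the seam), `V = seamTwist L θ` and `s ∈ [0, 1]`,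
`‖τ^{H + sV}_t(V) − τ^{H_T + sV}_t(V)‖ ≤ N (2‖V‖ N · 2J²|t| e^{44eJ|t| − m}) |t|` (boundary terms not meeting the seam),
`J = 2 + |U| + 2|θ|`, `N` = the number of terms of the seam-augmented family, `m` = any common lower bound of the levels
`δ_Z` (vanishing on `supp Z`, `1`-Lipschitz along torus edges) on the supports meeting the seam columns, over the
Hubbard terms `Z` outside the collar that meet `X` — e.g. `m = r − 3` for the circular `x₁`-distance and the collar
`|x₁| ≤ r`.  Ingredients: the supported-family leakage bound (PART 7c) in scalar form (§1) and the seam-augmented family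
of PART 7c (torus data): degree `≤ 4`, at most `22` supports meeting a given one.  What is left to the stub: the level
functions (circular distance), `‖V‖ ≤ 4L|θ|` (`norm_seamTwist_le`), and the choice `r ≍ L/4`, `T ≍ L`.
Sources: Hastings–Koma 2006 App. A; Capel–Moscolari–Teufel–Wessel, arXiv:2310.09182, Thm. 14 (input (ii)); Watanabe
2019 §4.1.  SC in the Hubbard model is NOT proved by anything here.
-/

noncomputable section

open Matrix Finset
open Literature.MathematicalPhysics.QuantumLattice
open Literature.Probability.LatticeModels

namespace Summit.Ventures.CertifiedManyBodySolver.Theorems.TcThermcert1.GaugeQbpFarSeam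

open scoped Matrix.Norms.L2Operator

/-! ### §1 Scalar form of the supported-family leakage bound -/

section Scalar

variable {Λ : Type*} [LinearOrder Λ] [Fintype Λ] (G : SimpleGraph Λ) {ι : Type*} [Fintype ι] [DecidableEq ι]

omit [Fintype Λ] [Fintype ι] [DecidableEq ι] in
/-- The support of a local Hubbard term has at most two sites. [folklore] -/
theorem card_hubbardTermSupp_le_two [DecidableRel G.Adj] (Z : HubbardIdx G) : (hubbardTermSupp G Z).card ≤ 2 := by
  cases Z with
  | inl p => exact Finset.card_insert_le _ _ |>.trans (by simp)
  | inr x => simp [hubbardTermSupp]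

/-- **Scalar leakage bound.**  In `norm_heisenbergEvolution_sub_restricted_le_of_supported`, when the boundary terms
(outside `T`, meeting the collar `X`) are disjoint from `X_V` their commutators with `V` vanish, and every remaining summand
is at most `2‖V‖ · N_V · 2J²|t| e^{2eJD|t| − m}`, `m` a common lower bound of the levels `δ_Z` on the supports meeting
`X_V` (over the boundary terms `Z`), `N_V` the number of supports meeting `X_V`; the sum is at most the number of
boundary terms times that — exponentially small as long as `m ≫ 2eJD|t|` (outside the light cone).
(The `DecidableEq` instance of the matrix index type is an implicit argument, unified at the use site: at the
concrete torus types two such instances coexist, cf. `SectorFourierProjection`.) [cite: HastingsKoma2006, App. A] -/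
theorem norm_heisenbergEvolution_sub_restricted_le_of_level {instDE : DecidableEq (Finset (Orb Λ))} (supp : ι → Finset Λ)
    (hne : ∀ Z, (supp Z).Nonempty) (hadj : ∀ Z {z w : Λ}, z ∈ supp Z → w ∈ supp Z → z = w ∨ G.Adj z w)
    {D : ℕ} (hD : ∀ Z, (Finset.univ.filter fun Z' => ¬ Disjoint (supp Z') (supp Z)).card ≤ D)
    (k : ι → Matrix (Finset (Orb Λ)) (Finset (Orb Λ)) ℂ) (hk : ∀ Z, (k Z).IsHermitian)
    (hkloc : ∀ Z, k Z ∈ carEvenSubalgebra (orbSet (supp Z)))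
    {J : ℝ} (hJ0 : 0 ≤ J) (hJ : ∀ Z, ‖k Z‖ ≤ J)
    (T : Finset ι) {X : Finset Λ} (hT : ∀ Z ∈ T, supp Z ⊆ X)
    {XV : Finset Λ} (hXV : XV ⊆ X) {V : Matrix (Finset (Orb Λ)) (Finset (Orb Λ)) ℂ}
    (hV : V ∈ carEvenSubalgebra (orbSet XV))
    (δ : ι → Λ → ℕ) (hδ0 : ∀ Z, ∀ y ∈ supp Z, δ Z y = 0) (hδ1 : ∀ Z x y, G.Adj x y → δ Z x ≤ δ Z y + 1)
    (hfar : ∀ Z, Z ∉ T → ¬ Disjoint (supp Z) X → Disjoint (supp Z) XV)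
    (m : ℕ) (hm : ∀ Z, Z ∉ T → ¬ Disjoint (supp Z) X →
      ∀ Z', ¬ Disjoint (supp Z') XV → ∀ z ∈ supp Z', m ≤ δ Z z) (t : ℝ) :
    ‖heisenbergEvolution (∑ Z, k Z) t V - heisenbergEvolution (∑ Z ∈ T, k Z) t V‖ ≤
      ((Tᶜ.filter (fun Z => ¬ Disjoint (supp Z) X)).card *
        (2 * ‖V‖ * ((Finset.univ.filter (fun Z' : ι => ¬ Disjoint (supp Z') XV)).card *
          (2 * J * J * |t| * Real.exp (Real.exp 1 * (2 * J * D) * |t| - m))))) * |t| := by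
  -- the statement is made over an arbitrary `DecidableEq` instance of the matrix index type (`instDE`, unified from
  -- the goal at the use site); it equals the canonical one by `Subsingleton.elim`
  obtain rfl : instDE = Finset.decidableEq := Subsingleton.elim _ _
  refine (norm_heisenbergEvolution_sub_restricted_le_of_supported G supp hne hadj hD k hk hkloc hJ0 hJ T hT hXV hV δ
    hδ0 hδ1 t).trans (mul_le_mul_of_nonneg_right ?_ (abs_nonneg t))
  refine (Finset.sum_le_card_nsmul _ _ _ fun Z hZ => ?_).trans (by rw [nsmul_eq_mul])
  have hZT : Z ∉ T := Finset.mem_compl.1 (Finset.mem_filter.1 hZ).1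
  have hZX : ¬ Disjoint (supp Z) X := (Finset.mem_filter.1 hZ).2
  -- the boundary terms are far from `X_V`: `[V, k Z] = 0`
  rw [norm_sub_eq_zero_iff.mpr (commute_of_mem_carEvenSubalgebra (hkloc Z) (carEvenSubalgebra_le_carSubalgebra _ hV)
    (disjoint_orbSet (hfar Z hZT hZX))).eq.symm, zero_add]
  refine mul_le_mul_of_nonneg_left ?_ (by positivity)
  · refine (Finset.sum_le_card_nsmul _ _ _ fun Z' hZ' => ?_).trans (by rw [nsmul_eq_mul])
    have hZ'' : ¬ Disjoint (supp Z') XV := (Finset.mem_filter.1 hZ').2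
    have h1 : 2 * J * ‖k Z‖ * |t| ≤ 2 * J * J * |t| :=
      mul_le_mul_of_nonneg_right (mul_le_mul_of_nonneg_left (hJ Z) (by positivity)) (abs_nonneg t)
    have hml : (m : ℝ) ≤ ((supp Z').inf' (hne Z') (δ Z) : ℕ) :=
      Nat.cast_le.2 ((Finset.le_inf'_iff _ _).2 (hm Z hZT hZX Z' hZ''))
    have h2 : Real.exp (Real.exp 1 * (2 * J * D) * |t| - ((supp Z').inf' (hne Z') (δ Z) : ℕ)) ≤
        Real.exp (Real.exp 1 * (2 * J * D) * |t| - m) := Real.exp_le_exp.2 (sub_le_sub_left hml _)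
    exact mul_le_mul h1 h2 (Real.exp_pos _).le (by positivity)

end Scalar

/-! ### §2 The seam dynamics on the Hubbard torus -/

section Torus

variable (L : ℕ) [NeZero L]

/-- **At most `22` supports of the seam-augmented family meet a given one** (`≤ 2·(2·4+1)` Hubbard terms — degree `≤ 4`,
supports of `≤ 2` sites — and `≤ 2·2` seam pairs). [folklore] -/
theorem card_filter_not_disjoint_seamAugmentedSupp_le
    (Z₀ : HubbardIdx (fermionTorusGraph 2 L) ⊕ (ZMod L × Fin 2)) :
    (Finset.univ.filter fun Z' : HubbardIdx (fermionTorusGraph 2 L) ⊕ (ZMod L × Fin 2) =>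
      ¬ Disjoint (Sum.elim (hubbardTermSupp (fermionTorusGraph 2 L))
          (fun p => ({FermionTorus.ofTorusSite (![0, p.1] : TorusSite 2 L),
            FermionTorus.ofTorusSite (![-1, p.1] : TorusSite 2 L)} : Finset (FermionTorus 2 L))) Z')
        (Sum.elim (hubbardTermSupp (fermionTorusGraph 2 L))
          (fun p => ({FermionTorus.ofTorusSite (![0, p.1] : TorusSite 2 L),
            FermionTorus.ofTorusSite (![-1, p.1] : TorusSite 2 L)} : Finset (FermionTorus 2 L))) Z₀)).card ≤ 22 := by
  set W : Finset (FermionTorus 2 L) := Sum.elim (hubbardTermSupp (fermionTorusGraph 2 L))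
    (fun p => ({FermionTorus.ofTorusSite (![0, p.1] : TorusSite 2 L),
      FermionTorus.ofTorusSite (![-1, p.1] : TorusSite 2 L)} : Finset (FermionTorus 2 L))) Z₀ with hW
  have hWc : W.card ≤ 2 := by
    rw [hW]
    rcases Z₀ with Z | p
    · exact card_hubbardTermSupp_le_two (fermionTorusGraph 2 L) Z
    · exact Finset.card_le_two
  have hΔ : ∀ x : FermionTorus 2 L, (Finset.univ.filter fun y => (fermionTorusGraph 2 L).Adj x y).card ≤ 2 * 2 :=
    fun x => card_filter_adj_fermionTorusGraph_le L 2 x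
  have h1 := card_filter_not_disjoint_hubbardTermSupp_le (fermionTorusGraph 2 L) hΔ W
  have h2 := card_filter_seamSites_not_disjoint_le L W
  rw [← Finset.card_toLeft_add_card_toRight]
  refine (add_le_add ((le_of_eq ?_).trans h1) ((le_of_eq ?_).trans h2)).trans (by omega)
  · congr 1
    ext a
    simp only [Finset.mem_toLeft, Finset.mem_filter, Finset.mem_univ, true_and, Sum.elim_inl]
  · congr 1
    ext b
    simp only [Finset.mem_toRight, Finset.mem_filter, Finset.mem_univ, true_and, Sum.elim_inr]

set_option synthInstance.maxSize 1024 in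
/-- **Leakage bound for the seam dynamics on the Hubbard torus** (hypothesis `hε` of `exists_qbp_conjugation_pair` up
to the level functions).  `H = hubbardTorusTT'Flux L 0 U 0`, `H_T = Σ_{Z ∈ T}` Hubbard terms with supports in the collar
`X ⊇` seam columns, `V = seamTwist L θ`, `s ∈ [0, 1]`, levels `δ_Z` vanishing on `supp Z` and `1`-Lipschitz along
edges with common lower bound `m` on the supports meeting the seam columns, over the boundary terms: then
`‖τ^{H + sV}_t(V) − τ^{H_T + sV}_t(V)‖ ≤ N (2‖V‖ N 2J²|t| e^{2eJ·22|t| − m}) |t|`, `J = 2 + |U| + 2|θ|`,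
`N = |HubbardIdx ⊕ (ZMod L × Fin 2)|`, provided the boundary terms (outside `T`, meeting `X`) do not meet the seam columns.  Capel–Moscolari–Teufel–Wessel, arXiv:2310.09182, proof of Thm. 14, input (ii);
Hastings–Koma 2006 App. A. [cite: CapelEtAl2023, Thm. 14] -/
theorem norm_seamDynamics_sub_collar_le (U θ : ℝ) {s : ℝ} (hs : s ∈ Set.Icc (0 : ℝ) 1)
    (T : Finset (HubbardIdx (fermionTorusGraph 2 L))) {X : Finset (FermionTorus 2 L)}
    (hT : ∀ Z ∈ T, hubbardTermSupp (fermionTorusGraph 2 L) Z ⊆ X)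
    (hX : ∀ y : ZMod L, FermionTorus.ofTorusSite (![0, y] : TorusSite 2 L) ∈ X ∧
      FermionTorus.ofTorusSite (![-1, y] : TorusSite 2 L) ∈ X)
    (δ : HubbardIdx (fermionTorusGraph 2 L) ⊕ (ZMod L × Fin 2) → FermionTorus 2 L → ℕ)
    (hδ0 : ∀ Z, ∀ y ∈ Sum.elim (hubbardTermSupp (fermionTorusGraph 2 L))
        (fun p => ({FermionTorus.ofTorusSite (![0, p.1] : TorusSite 2 L),
          FermionTorus.ofTorusSite (![-1, p.1] : TorusSite 2 L)} : Finset (FermionTorus 2 L))) Z, δ Z y = 0)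
    (hδ1 : ∀ Z x y, (fermionTorusGraph 2 L).Adj x y → δ Z x ≤ δ Z y + 1)
    (hfar : ∀ Z : HubbardIdx (fermionTorusGraph 2 L), Z ∉ T →
      ¬ Disjoint (hubbardTermSupp (fermionTorusGraph 2 L) Z) X →
      Disjoint (hubbardTermSupp (fermionTorusGraph 2 L) Z)
        ((Finset.univ : Finset (ZMod L)).biUnion fun y =>
          ({FermionTorus.ofTorusSite (![0, y] : TorusSite 2 L),
            FermionTorus.ofTorusSite (![-1, y] : TorusSite 2 L)} : Finset (FermionTorus 2 L))))
    (m : ℕ)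
    (hm : ∀ Z : HubbardIdx (fermionTorusGraph 2 L), Z ∉ T →
      ¬ Disjoint (hubbardTermSupp (fermionTorusGraph 2 L) Z) X →
      ∀ Z' : HubbardIdx (fermionTorusGraph 2 L) ⊕ (ZMod L × Fin 2),
        ¬ Disjoint (Sum.elim (hubbardTermSupp (fermionTorusGraph 2 L))
            (fun p => ({FermionTorus.ofTorusSite (![0, p.1] : TorusSite 2 L),
              FermionTorus.ofTorusSite (![-1, p.1] : TorusSite 2 L)} : Finset (FermionTorus 2 L))) Z')
          ((Finset.univ : Finset (ZMod L)).biUnion fun y =>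
            ({FermionTorus.ofTorusSite (![0, y] : TorusSite 2 L),
              FermionTorus.ofTorusSite (![-1, y] : TorusSite 2 L)} : Finset (FermionTorus 2 L))) →
        ∀ z ∈ Sum.elim (hubbardTermSupp (fermionTorusGraph 2 L))
            (fun p => ({FermionTorus.ofTorusSite (![0, p.1] : TorusSite 2 L),
              FermionTorus.ofTorusSite (![-1, p.1] : TorusSite 2 L)} : Finset (FermionTorus 2 L))) Z',
          m ≤ δ (Sum.inl Z) z)
    (t : ℝ) :
    ‖heisenbergEvolution (hubbardTorusTT'Flux L 0 U 0 + (s : ℂ) • seamTwist L θ) t (seamTwist L θ) -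
        heisenbergEvolution (∑ Z ∈ T, hubbardTermOp (fermionTorusGraph 2 L) 1 U 0 Z + (s : ℂ) • seamTwist L θ) t
          (seamTwist L θ)‖ ≤
      (Fintype.card (HubbardIdx (fermionTorusGraph 2 L) ⊕ (ZMod L × Fin 2)) *
        (2 * ‖seamTwist L θ‖ *
          (Fintype.card (HubbardIdx (fermionTorusGraph 2 L) ⊕ (ZMod L × Fin 2)) *
            (2 * (2 + |U| + 2 * |θ|) * (2 + |U| + 2 * |θ|) * |t| *
              Real.exp (Real.exp 1 * (2 * (2 + |U| + 2 * |θ|) * ((22 : ℕ) : ℝ)) * |t| - m))))) * |t| := by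
  have hJ0 : (0 : ℝ) ≤ 2 + |U| + 2 * |θ| := by positivity
  -- the seam columns
  have hS : ∀ y : ZMod L,
      FermionTorus.ofTorusSite (![0, y] : TorusSite 2 L) ∈ ((Finset.univ : Finset (ZMod L)).biUnion fun y =>
        ({FermionTorus.ofTorusSite (![0, y] : TorusSite 2 L), FermionTorus.ofTorusSite (![-1, y] : TorusSite 2 L)} :
          Finset (FermionTorus 2 L))) ∧
      FermionTorus.ofTorusSite (![-1, y] : TorusSite 2 L) ∈ ((Finset.univ : Finset (ZMod L)).biUnion fun y =>
        ({FermionTorus.ofTorusSite (![0, y] : TorusSite 2 L), FermionTorus.ofTorusSite (![-1, y] : TorusSite 2 L)} :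
          Finset (FermionTorus 2 L))) := fun y =>
    ⟨Finset.mem_biUnion.2 ⟨y, Finset.mem_univ _, Finset.mem_insert_self _ _⟩,
      Finset.mem_biUnion.2 ⟨y, Finset.mem_univ _, Finset.mem_insert_of_mem (Finset.mem_singleton_self _)⟩⟩
  have hXV : ((Finset.univ : Finset (ZMod L)).biUnion fun y =>
      ({FermionTorus.ofTorusSite (![0, y] : TorusSite 2 L), FermionTorus.ofTorusSite (![-1, y] : TorusSite 2 L)} :
        Finset (FermionTorus 2 L))) ⊆ X := by
    intro x hx
    obtain ⟨y, -, hy⟩ := Finset.mem_biUnion.1 hx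
    simp only [Finset.mem_insert, Finset.mem_singleton] at hy
    rcases hy with rfl | rfl
    · exact (hX y).1
    · exact (hX y).2
  rw [← sum_seamAugmented_eq L U θ s, ← sum_seamAugmented_disjSum_eq L U θ s T]
  refine (norm_heisenbergEvolution_sub_restricted_le_of_level (fermionTorusGraph 2 L) _ ?_ ?_ (D := 22) ?_ _
    (isHermitian_seamAugmented L U θ s) (seamAugmented_mem_carEvenSubalgebra L U θ s) hJ0
    (norm_seamAugmented_le L U θ hs) (T.disjSum Finset.univ) ?_ hXV (seamTwist_mem_carEvenSubalgebra L θ hS)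
    δ hδ0 hδ1 ?_ m ?_ t).trans ?_
  · -- supports are nonempty
    intro Z
    cases Z with
    | inl Z => exact hubbardTermSupp_nonempty _ Z
    | inr p => exact ⟨_, Finset.mem_insert_self _ _⟩
  · -- supports have diameter `≤ 1`
    intro Z z w hz hw
    cases Z with
    | inl Z => exact eq_or_adj_of_mem_hubbardTermSupp _ hz hw
    | inr p => exact eq_or_adj_of_mem_seamSites L p.1 hz hw
  · -- at most `22` supports meet a given one
    intro Z
    convert card_filter_not_disjoint_seamAugmentedSupp_le L Z using 3
  · -- the kept terms live in the collar
    intro Z hZ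
    rw [Finset.mem_disjSum] at hZ
    rcases hZ with ⟨Z₁, hZ₁, rfl⟩ | ⟨p, -, rfl⟩
    · exact hT Z₁ hZ₁
    · intro x hx
      simp only [Sum.elim_inr, Finset.mem_insert, Finset.mem_singleton] at hx
      rcases hx with rfl | rfl
      · exact (hX p.1).1
      · exact (hX p.1).2
  · -- the boundary terms do not meet the seam columns
    intro Z hZ hZX
    cases Z with
    | inl Z₁ => exact hfar Z₁ (fun h => hZ (Finset.inl_mem_disjSum.2 h)) hZX
    | inr p => exact absurd (Finset.inr_mem_disjSum.2 (Finset.mem_univ _)) hZ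
  · -- the levels are `≥ m` near the seam
    intro Z hZ hZX Z' hZ' z hz
    cases Z with
    | inl Z₁ => exact hm Z₁ (fun h => hZ (Finset.inl_mem_disjSum.2 h)) hZX Z' hZ' z hz
    | inr p => exact absurd (Finset.inr_mem_disjSum.2 (Finset.mem_univ _)) hZ
  · -- count the boundary terms and the terms near the seam by the total number of terms
    refine mul_le_mul_of_nonneg_right ?_ (abs_nonneg t)
    have hc : 0 ≤ 2 * (2 + |U| + 2 * |θ|) * (2 + |U| + 2 * |θ|) * |t| *
        Real.exp (Real.exp 1 * (2 * (2 + |U| + 2 * |θ|) * ((22 : ℕ) : ℝ)) * |t| - m) := by positivity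
    gcongr
    · exact Finset.card_le_univ _
    · exact Finset.card_le_univ _

end Torus

end Summit.Ventures.CertifiedManyBodySolver.Theorems.TcThermcert1.GaugeQbpFarSeam

end
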